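import Summits.HodgeConjecture.HodgeConjecture.Theorems.HeckePrymWeilWeilTwelvefoldsSqrtMinus7IsotypicHeckePrymPlaneMultiplicity
import Summits.HodgeConjecture.HodgeConjecture.Theorems.HeckePrymWeilWeilTwelvefoldsSqrtMinus7IsotypicHeckePrymPlaneCoinvariants
import Literature.AlgebraicGeometry.HodgeTheory.WeilClassesCyclicPrymDegreeSeven
import Literature.AlgebraicTopology.SingularHomology.FreeActionLefschetzNumber
import Mathlib.RingTheory.PowerBasis
import Mathlib.RingTheory.Polynomial.Cyclotomic.Roots
import HarnessLib

/-!
# `tr((σ^*)ʲ | H¹(C)) = 2` for a free automorphism of order `7`, WITHOUT the Lefschetz fixed-point theorem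

Helper file for line `isotypic-unimodular-saturation`, stub `stub_heckePrymWeilPlane`
(`--supports stmt-HodgeConjecture-1261`).  The Chevalley–Weil count behind `dim P' = 12` needs the
traces of the powers of `σ^*` on `H¹(C(ℂ); ℂ)` for a fixed-point-free automorphism `σ` of order `7` of a
smooth projective curve `C`.  Classically each equals `2` by the Lefschetz fixed-point theorem (absent from
the tree).  Here they are computed UNCONDITIONALLY from two tree theorems:

* Smith theory + transfer (`AlgebraicTopology/SingularHomology/FreeActionLefschetzNumber`,
  `OrbitSpace.euler_eq_prime_mul_euler`, `finrank_cohomology_orbitSpace_eq`): for a free homeomorphism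
  `a` of prime period `7` of a closed manifold the Lefschetz numbers of `a, …, a⁶` SUM to zero
  (`lefschetz_sum_of_free_order_seven`: `Σ_{j<7} L(j) = 7 χ(M/⟨a⟩) = χ(M) = L(0)`);
* Galois symmetry: the traces `tr Tʲ` (`T = σ^*|H¹`, `T⁷ = 1`) are RATIONAL
  (`trace_complexBetti_map_mem_range_ratCast`), and a rational combination `Σ_{b=1}^{6} u_b ζ₇ᵇ ∈ ℚ` has
  all `u_b` equal (`rat_eq_of_sum_mul_zeta_pow`: `1, ζ, …, ζ⁵` are `ℚ`-independent, `minpoly_ℚ ζ₇ = Φ₇`,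
  Mathlib `cyclotomic_eq_minpoly_rat` + `linearIndependent_pow`); applied to
  `7·dim Eig(T, ζ) = dim V + Σ_k ζ^{-k} tr Tᵏ` (`…Multiplicity.seven_mul_finrank_eigenspace`) this forces
  `tr T = tr T² = ⋯ = tr T⁶` (`trace_pow_eq_trace_of_rational`).

Hence `6 · (2 - tr T) = Σ_{j=1}^{6} L(j) = 0` on the closed surface `C(ℂ)` (`H⁰`, `H²` contribute `1 + 1`:
`σ^*` acts on the line `H²` by a rational `l` with `l⁷ = 1`, `trace_complexBetti_map_two_eq_one`), i.e.
**`trace_pow_complexBetti_map_one_eq_two_of_free`**.  No definitions (the homeomorphism of `C(ℂ)` is a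
local `let`); no named facts.
-/

noncomputable section

set_option linter.dupNamespace false

open CategoryTheory Polynomial
open Literature.AlgebraicGeometry Literature.AlgebraicGeometry.Motives
  Literature.AlgebraicGeometry.HodgeTheory Literature.AlgebraicTopology.SingularHomology

namespace Summit.HodgeConjecture.HodgeConjecture.Theorems.WeilTwelvefoldsSqrtMinus7.IsotypicUnimodularSaturation

/-! ### Galois symmetry: a rational combination of `ζ, …, ζ⁶` lying in `ℚ` has equal coefficients -/

/-- **`Σ_{b=1}^{6} u_b ζ₇ᵇ = u₀` with all `uᵢ ∈ ℚ` forces `u₁ = ⋯ = u₆`** (`1, ζ₇, …, ζ₇⁵` are linearly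
independent over `ℚ`: `minpoly_ℚ ζ₇ = Φ₇` has degree `6`). [folklore] -/
theorem rat_eq_of_sum_mul_zeta_pow (u₀ u₁ u₂ u₃ u₄ u₅ u₆ : ℚ)
    (h : (u₁ : ℂ) * Complex.exp (2 * (Real.pi : ℂ) * Complex.I / 7) +
      u₂ * Complex.exp (2 * (Real.pi : ℂ) * Complex.I / 7) ^ 2 +
      u₃ * Complex.exp (2 * (Real.pi : ℂ) * Complex.I / 7) ^ 3 +
      u₄ * Complex.exp (2 * (Real.pi : ℂ) * Complex.I / 7) ^ 4 +
      u₅ * Complex.exp (2 * (Real.pi : ℂ) * Complex.I / 7) ^ 5 +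
      u₆ * Complex.exp (2 * (Real.pi : ℂ) * Complex.I / 7) ^ 6 = u₀) :
    u₁ = u₆ ∧ u₂ = u₆ ∧ u₃ = u₆ ∧ u₄ = u₆ ∧ u₅ = u₆ := by
  set z : ℂ := Complex.exp (2 * (Real.pi : ℂ) * Complex.I / 7) with hz
  have hζ : IsPrimitiveRoot z 7 := Negative.ζ7_isPrimitiveRoot
  have hdeg : (minpoly ℚ z).natDegree = 6 := by
    rw [← Polynomial.cyclotomic_eq_minpoly_rat hζ (by norm_num), Polynomial.natDegree_cyclotomic,
      Nat.totient_prime (by norm_num)]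
  have hli := linearIndependent_pow (K := ℚ) z
  rw [hdeg] at hli
  have hΦ : 1 + z + z ^ 2 + z ^ 3 + z ^ 4 + z ^ 5 + z ^ 6 = 0 := zeta7_cyclotomic
  let g : Fin 6 → ℚ := ![-u₆ - u₀, u₁ - u₆, u₂ - u₆, u₃ - u₆, u₄ - u₆, u₅ - u₆]
  have hg : ∑ i, g i • z ^ (i : ℕ) = 0 := by
    simp only [Fin.sum_univ_succ, Fin.sum_univ_zero, g, Matrix.cons_val_zero, Matrix.cons_val_succ,
      Fin.val_zero, Fin.val_succ, pow_zero, Rat.smul_def, add_zero]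
    push_cast
    linear_combination h - (u₆ : ℂ) * hΦ
  have h0 := Fintype.linearIndependent_iff.1 hli g hg
  have e1 : u₁ - u₆ = 0 := h0 1
  have e2 : u₂ - u₆ = 0 := h0 2
  have e3 : u₃ - u₆ = 0 := h0 3
  have e4 : u₄ - u₆ = 0 := h0 4
  have e5 : u₅ - u₆ = 0 := h0 5
  exact ⟨sub_eq_zero.1 e1, sub_eq_zero.1 e2, sub_eq_zero.1 e3, sub_eq_zero.1 e4, sub_eq_zero.1 e5⟩

/-- **Rational traces of the powers of an order-`7` operator are all equal**: if `T⁷ = 1` on a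
finite-dimensional complex space and `tr Tʲ ∈ ℚ` for `1 ≤ j ≤ 6`, then `tr Tʲ = tr T` for `1 ≤ j ≤ 6`
(the multiplicities of the Galois-conjugate primitive eigenvalues agree:
`7·dim Eig(T, ζ) - dim V = Σ_k ζ^{-k} tr Tᵏ ∈ ℚ` and `rat_eq_of_sum_mul_zeta_pow`). [folklore] -/
theorem trace_pow_eq_trace_of_rational {V : Type*} [AddCommGroup V] [Module ℂ V] [FiniteDimensional ℂ V]
    (T : Module.End ℂ V) (hT : T ^ 7 = 1)
    (hrat : ∀ j : ℕ, 1 ≤ j → j ≤ 6 → ∃ q : ℚ, (q : ℂ) = LinearMap.trace ℂ V (T ^ j)) :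
    ∀ j : ℕ, 1 ≤ j → j ≤ 6 → LinearMap.trace ℂ V (T ^ j) = LinearMap.trace ℂ V T := by
  obtain ⟨t1, ht1⟩ := hrat 1 le_rfl (by norm_num)
  obtain ⟨t2, ht2⟩ := hrat 2 (by norm_num) (by norm_num)
  obtain ⟨t3, ht3⟩ := hrat 3 (by norm_num) (by norm_num)
  obtain ⟨t4, ht4⟩ := hrat 4 (by norm_num) (by norm_num)
  obtain ⟨t5, ht5⟩ := hrat 5 (by norm_num) (by norm_num)
  obtain ⟨t6, ht6⟩ := hrat 6 (by norm_num) (by norm_num)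
  rw [pow_one] at ht1
  have h := seven_mul_finrank_eigenspace T hT zeta7_pow_seven
  rw [← ht1, ← ht2, ← ht3, ← ht4, ← ht5, ← ht6] at h
  obtain ⟨e6, e5, e4, e3, e2⟩ := rat_eq_of_sum_mul_zeta_pow
    (7 * Module.finrank ℂ (T.eigenspace (Complex.exp (2 * (Real.pi : ℂ) * Complex.I / 7))) -
      Module.finrank ℂ V : ℚ) t6 t5 t4 t3 t2 t1 (by push_cast; linear_combination -h)
  intro j hj1 hj6
  interval_cases j
  · rw [pow_one]
  · rw [← ht2, ← ht1, e2]
  · rw [← ht3, ← ht1, e3]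
  · rw [← ht4, ← ht1, e4]
  · rw [← ht5, ← ht1, e5]
  · rw [← ht6, ← ht1, e6]

/-! ### Smith theory: the Lefschetz numbers of a free `ℤ/7`-action on a closed manifold sum to zero -/

/-- **For a free homeomorphism `a` of prime period `7` of a closed topological `n`-manifold `M`, the
Lefschetz numbers `L(j) = Σ_k (-1)ᵏ tr((a^*)ʲ | Hᵏ(M; ℂ))`, `1 ≤ j ≤ 6`, sum to `0`**:
`Σ_{j<7} L(j) = 7·χ(M/⟨a⟩)` (transfer: `Hᵏ(M/⟨a⟩; ℂ) = Hᵏ(M; ℂ)^{⟨a⟩}`, the averaging projector) and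
`χ(M) = 7·χ(M/⟨a⟩)` (Smith–Floyd; Bredon Ch. III Thm. 7.10, free case, PROVED in the tree), while
`L(0) = χ(M)`. [cite: Bredon1972, Ch. III Thm. 7.10] [cite: HatcherAT2002, §3.G Prop. 3G.1] -/
theorem lefschetz_sum_of_free_order_seven {M : Type} [TopologicalSpace M] {n : ℕ} [T2Space M]
    [CompactSpace M] [ChartedSpace (EuclideanSpace ℝ (Fin n)) M] [Nonempty M] (a : M ≃ₜ M)
    (ha : a ^ 7 = 1) (hfree : ∀ i : ℕ, 0 < i → i < 7 → ∀ x : M, (a ^ i) x ≠ x) :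
    ∑ j ∈ Finset.Icc 1 6, ∑ k ∈ Finset.range (n + 1),
      (-1 : ℂ) ^ k * LinearMap.trace ℂ _ ((singularCohomology.map ℂ ℂ (a : C(M, M)) k).hom ^ j) = 0 := by
  haveI := ChartedSpace.locallyCompactSpace (EuclideanSpace ℝ (Fin n)) M
  haveI hfin : ∀ k, Module.Finite ℂ (singularCohomology ℂ ℂ M k) :=
    finite_singularCohomology_of_closedManifold ℂ n M
  haveI : Fact (Nat.Prime 7) := ⟨by norm_num⟩
  let A : ∀ k : ℕ, Module.End ℂ (singularCohomology ℂ ℂ M k) :=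
    fun k => (singularCohomology.map ℂ ℂ (a : C(M, M)) k).hom
  have hApow : ∀ j k, (singularCohomology.map ℂ ℂ ((a ^ j : M ≃ₜ M) : C(M, M)) k).hom = A k ^ j :=
    fun j k => singularCohomology_map_homeomorph_pow_hom a j k
  have hA7 : ∀ k, A k ^ 7 = 1 := fun k => by
    rw [← hApow, ha]
    have hcoe : ((1 : M ≃ₜ M) : C(M, M)) = ContinuousMap.id M := rfl
    rw [hcoe, singularCohomology.map_id]
    rfl
  set L : ℕ → ℂ := fun j => ∑ k ∈ Finset.range (n + 1), (-1 : ℂ) ^ k * LinearMap.trace ℂ _ (A k ^ j)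
    with hLdef
  have hL : ∀ j, L j = ∑ k ∈ Finset.range (n + 1), (-1 : ℂ) ^ k * LinearMap.trace ℂ _ (A k ^ j) :=
    fun j => rfl
  change ∑ j ∈ Finset.Icc 1 6, L j = 0
  -- `L 0 = χ(M)`, `χ(M) = 7 χ(M/⟨a⟩)`, `7 χ(M/⟨a⟩) = Σ_{j<7} L j`
  have he := cast_eulerTrunc (n + 1)
  have hL0 : L 0 = (eulerTrunc (n + 1) M : ℂ) := by
    rw [he, hL]
    refine Finset.sum_congr rfl fun k _ => ?_
    rw [pow_zero, LinearMap.trace_one]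
  have hE : (eulerTrunc (n + 1) M : ℂ) = 7 * (eulerTrunc (n + 1) (OrbitSpace a) : ℂ) := by
    have h := OrbitSpace.euler_eq_prime_mul_euler (n := n) a ha hfree
    change eulerTrunc (n + 1) M = (7 : ℕ) * eulerTrunc (n + 1) (OrbitSpace a) at h
    exact_mod_cast h
  have hS : (7 : ℂ) * (eulerTrunc (n + 1) (OrbitSpace a) : ℂ) = ∑ j ∈ Finset.range 7, L j := by
    rw [he]
    have h := mul_euler_eq_sum_traces (N := n + 1) (m := 7) (fun k => singularCohomology ℂ ℂ M k)
      A hA7 (by norm_num)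
      (fun k => Module.finrank ℂ (singularCohomology ℂ ℂ (OrbitSpace a) k)) (fun k => by
        rw [OrbitSpace.finrank_cohomology_orbitSpace_eq a ha hfree k])
    rw [Nat.cast_ofNat] at h
    rw [h]
  have hsplit : ∑ j ∈ Finset.range 7, L j = L 0 + ∑ j ∈ Finset.Icc 1 6, L j := by
    rw [Finset.range_eq_Ico, Finset.sum_eq_sum_Ico_succ_bot (by norm_num : 0 < 7)]
    rfl
  have key : L 0 + ∑ j ∈ Finset.Icc 1 6, L j = L 0 := by
    rw [← hsplit, ← hS, ← hE, hL0]
  exact add_eq_left.1 key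

/-! ### The curve: all six traces equal `2` -/

section Curve

variable {C : SchemeOver ℂ}

/-- **An automorphism of order `7` acts trivially on `H²(C(ℂ); ℂ)`** of a smooth projective curve: its
trace `l` on the line `H²` is rational with `l⁷ = 1`, hence `l = 1`. [folklore] -/
theorem trace_complexBetti_map_two_eq_one (hC : IsSmoothProjective 1 C) (σ : C ⟶ C)
    (hσ7 : σ ≫ σ ≫ σ ≫ σ ≫ σ ≫ σ ≫ σ = 𝟙 C) :
    LinearMap.trace ℂ _ (complexBetti.map σ 2).hom = 1 := by
  haveI := finite_complexBetti_of_isSmoothProjective hC 2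
  set l := LinearMap.trace ℂ _ (complexBetti.map σ 2).hom with hl
  have h7 : l ^ 7 = 1 := by
    rw [hl, ← trace_pow_complexBetti_map_two_of_curve hC σ 7]
    have e : (complexBetti.map σ 2).hom ^ 7 = (complexBetti.map (σ ≫ σ ≫ σ ≫ σ ≫ σ ≫ σ ≫ σ) 2).hom := by
      simp only [complexBetti_map_comp_hom', pow_succ, pow_zero, Module.End.one_eq_id,
        LinearMap.id_comp, Module.End.mul_eq_comp, LinearMap.comp_assoc]
    rw [e, hσ7, complexBetti.map_id, ModuleCat.hom_id, ← Module.End.one_eq_id, LinearMap.trace_one,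
      finrank_complexBetti_two_of_curve hC, Nat.cast_one]
  obtain ⟨q, hq⟩ := trace_complexBetti_map_mem_range_ratCast hC σ 2
  rw [← hl] at hq
  have hq7 : q ^ 7 = 1 := by exact_mod_cast (show ((q : ℂ)) ^ 7 = 1 by rw [hq, h7])
  have hq1 : q = 1 := (Odd.pow_inj (by decide : Odd 7)).1 (by rw [hq7, one_pow])
  rw [← hq, hq1, Rat.cast_one]

/-- **`tr((σ^*)ʲ | H¹(C(ℂ); ℂ)) = 2` for `j = 1, …, 6`**, for a fixed-point-free automorphism `σ` of
order `7` of a smooth projective complex curve — UNCONDITIONALLY (Smith theory + Galois symmetry, see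
the module docstring; classically the Lefschetz fixed-point theorem, Hatcher Thm. 2C.3; Patel–Zhang
Lemma 2.9 uses the Euler characteristic of the quotient, as here). [cite: PatelZhang2025PrymHodge, Lemma 2.9]
[cite: Bredon1972, Ch. III Thm. 7.10] -/
theorem trace_pow_complexBetti_map_one_eq_two_of_free {C : SchemeOver ℂ} (hC : IsSmoothProjective 1 C)
    (σ : C ⟶ C)
    (hσ7 : σ ≫ σ ≫ σ ≫ σ ≫ σ ≫ σ ≫ σ = 𝟙 C) (hfree : ∀ P : ComplexPoints C, P ≫ σ ≠ P) :
    ∀ j : ℕ, 1 ≤ j → j ≤ 6 → LinearMap.trace ℂ _ ((complexBetti.map σ 1).hom ^ j) = 2 := by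
  letI := hC.chartedSpace
  haveI := ComplexPoints.compactSpace_of_isSmoothProjective hC
  haveI := ComplexPoints.t2Space_of_isSmoothProjective hC
  haveI : Nonempty (ComplexPoints C) := nonempty_algPoints_of_isSmoothProjective hC
  haveI := finite_complexBetti_of_isSmoothProjective hC 1
  -- the powers of `σ` and of `T = σ^*|H¹`
  set T := (complexBetti.map σ 1).hom with hT
  have hpow : ∀ k : ℕ,
      (complexBetti.map (σ ≫ σ) k).hom = (complexBetti.map σ k).hom ^ 2 ∧
      (complexBetti.map (σ ≫ σ ≫ σ) k).hom = (complexBetti.map σ k).hom ^ 3 ∧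
      (complexBetti.map (σ ≫ σ ≫ σ ≫ σ) k).hom = (complexBetti.map σ k).hom ^ 4 ∧
      (complexBetti.map (σ ≫ σ ≫ σ ≫ σ ≫ σ) k).hom = (complexBetti.map σ k).hom ^ 5 ∧
      (complexBetti.map (σ ≫ σ ≫ σ ≫ σ ≫ σ ≫ σ) k).hom = (complexBetti.map σ k).hom ^ 6 ∧
      (complexBetti.map (σ ≫ σ ≫ σ ≫ σ ≫ σ ≫ σ ≫ σ) k).hom = (complexBetti.map σ k).hom ^ 7 := by
    intro k
    refine ⟨?_, ?_, ?_, ?_, ?_, ?_⟩ <;>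
      simp only [complexBetti_map_comp_hom', pow_succ, pow_zero, Module.End.one_eq_id,
        LinearMap.id_comp, Module.End.mul_eq_comp, LinearMap.comp_assoc]
  have hT7 : T ^ 7 = 1 := by
    rw [hT, ← (hpow 1).2.2.2.2.2, hσ7, complexBetti.map_id, ModuleCat.hom_id, Module.End.one_eq_id]
  -- the traces are rational, hence all equal
  have hrat : ∀ j : ℕ, 1 ≤ j → j ≤ 6 → ∃ q : ℚ, (q : ℂ) = LinearMap.trace ℂ _ (T ^ j) := by
    intro j hj1 hj6
    interval_cases j
    · obtain ⟨q, hq⟩ := trace_complexBetti_map_mem_range_ratCast hC σ 1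
      exact ⟨q, by rw [hq, hT, pow_one]⟩
    · obtain ⟨q, hq⟩ := trace_complexBetti_map_mem_range_ratCast hC (σ ≫ σ) 1
      exact ⟨q, by rw [hq, (hpow 1).1]⟩
    · obtain ⟨q, hq⟩ := trace_complexBetti_map_mem_range_ratCast hC (σ ≫ σ ≫ σ) 1
      exact ⟨q, by rw [hq, (hpow 1).2.1]⟩
    · obtain ⟨q, hq⟩ := trace_complexBetti_map_mem_range_ratCast hC (σ ≫ σ ≫ σ ≫ σ) 1
      exact ⟨q, by rw [hq, (hpow 1).2.2.1]⟩
    · obtain ⟨q, hq⟩ := trace_complexBetti_map_mem_range_ratCast hC (σ ≫ σ ≫ σ ≫ σ ≫ σ) 1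
      exact ⟨q, by rw [hq, (hpow 1).2.2.2.1]⟩
    · obtain ⟨q, hq⟩ := trace_complexBetti_map_mem_range_ratCast hC (σ ≫ σ ≫ σ ≫ σ ≫ σ ≫ σ) 1
      exact ⟨q, by rw [hq, (hpow 1).2.2.2.2.1]⟩
  have heq := trace_pow_eq_trace_of_rational T hT7 hrat
  -- the homeomorphism `a = σ(ℂ)` of the closed surface `C(ℂ)`, of period `7`, acting freely
  let a : ComplexPoints C ≃ₜ ComplexPoints C :=
    { toFun := AlgPoints.mapContinuous (L := ℂ) σ
      invFun := AlgPoints.mapContinuous (L := ℂ) (σ ≫ σ ≫ σ ≫ σ ≫ σ ≫ σ)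
      left_inv := fun x => by
        change AlgPoints.map (σ ≫ σ ≫ σ ≫ σ ≫ σ ≫ σ) (AlgPoints.map σ x) = x
        rw [← AlgPoints.map_comp_apply, hσ7, AlgPoints.map_id_apply]
      right_inv := fun x => by
        change AlgPoints.map σ (AlgPoints.map (σ ≫ σ ≫ σ ≫ σ ≫ σ ≫ σ) x) = x
        rw [← AlgPoints.map_comp_apply]
        simp only [Category.assoc]
        rw [hσ7, AlgPoints.map_id_apply]
      continuous_toFun := (AlgPoints.mapContinuous (L := ℂ) σ).continuous
      continuous_invFun := (AlgPoints.mapContinuous (L := ℂ) (σ ≫ σ ≫ σ ≫ σ ≫ σ ≫ σ)).continuous }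
  have ha1 : ∀ x, a x = AlgPoints.map σ x := fun x => rfl
  have hasucc : ∀ (m : ℕ) (β : C ⟶ C), (∀ x, (a ^ m) x = AlgPoints.map β x) →
      ∀ x, (a ^ (m + 1)) x = AlgPoints.map (σ ≫ β) x := by
    intro m β hβ x
    rw [pow_succ, Homeomorph.mul_apply, hβ]
    change AlgPoints.map β (AlgPoints.map σ x) = _
    rw [← AlgPoints.map_comp_apply]
  have ha1' : ∀ x, (a ^ 1) x = AlgPoints.map σ x := fun x => by rw [pow_one]; rfl
  have ha2 := hasucc 1 σ ha1'
  have ha3 := hasucc 2 _ ha2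
  have ha4 := hasucc 3 _ ha3
  have ha5 := hasucc 4 _ ha4
  have ha6 := hasucc 5 _ ha5
  have ha7 := hasucc 6 _ ha6
  have ha : a ^ 7 = 1 := by
    refine Homeomorph.ext fun x => ?_
    rw [ha7, hσ7, AlgPoints.map_id_apply, Homeomorph.one_apply]
  have hfreeA : ∀ i : ℕ, 0 < i → i < 7 → ∀ x : ComplexPoints C, (a ^ i) x ≠ x := by
    intro i hi0 hi7 x hx
    obtain ⟨h2, h3, h4, h5, h6⟩ := complexPoints_comp_pow_ne_of_pow_seven hσ7 hfree x
    interval_cases i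
    · exact hfree x (by rw [ha1'] at hx; exact hx)
    · exact h2 (by rw [ha2] at hx; exact hx)
    · exact h3 (by rw [ha3] at hx; exact hx)
    · exact h4 (by rw [ha4] at hx; exact hx)
    · exact h5 (by rw [ha5] at hx; exact hx)
    · exact h6 (by rw [ha6] at hx; exact hx)
  -- the Lefschetz sum, unfolded on the surface
  have hsum := lefschetz_sum_of_free_order_seven (n := 2 * 1) a ha hfreeA
  have hLj : ∀ j : ℕ, (∑ k ∈ Finset.range (2 * 1 + 1), (-1 : ℂ) ^ k *
      LinearMap.trace ℂ _ ((singularCohomology.map ℂ ℂ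
        (a : C(ComplexPoints C, ComplexPoints C)) k).hom ^ j)) =
      LinearMap.trace ℂ _ ((complexBetti.map σ 0).hom ^ j) -
        LinearMap.trace ℂ _ ((complexBetti.map σ 1).hom ^ j) +
        LinearMap.trace ℂ _ ((complexBetti.map σ 2).hom ^ j) := by
    intro j
    rw [show 2 * 1 + 1 = 3 from rfl, Finset.sum_range_succ, Finset.sum_range_succ, Finset.sum_range_one]
    change (-1 : ℂ) ^ 0 * LinearMap.trace ℂ _ ((complexBetti.map σ 0).hom ^ j) +
      (-1 : ℂ) ^ 1 * LinearMap.trace ℂ _ ((complexBetti.map σ 1).hom ^ j) +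
      (-1 : ℂ) ^ 2 * LinearMap.trace ℂ _ ((complexBetti.map σ 2).hom ^ j) = _
    ring
  simp only [hLj] at hsum
  -- `H⁰` and `H²` contribute `1 + 1`; the `H¹` traces are all `tr T`
  have hterm : ∀ j ∈ Finset.Icc 1 6,
      LinearMap.trace ℂ _ ((complexBetti.map σ 0).hom ^ j) -
        LinearMap.trace ℂ _ ((complexBetti.map σ 1).hom ^ j) +
        LinearMap.trace ℂ _ ((complexBetti.map σ 2).hom ^ j) = 2 - LinearMap.trace ℂ _ T := by
    intro j hj
    rw [Finset.mem_Icc] at hj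
    rw [trace_pow_complexBetti_map_zero hC σ j, trace_pow_complexBetti_map_two_of_curve hC σ j,
      trace_complexBetti_map_two_eq_one hC σ hσ7, one_pow, ← hT, heq j hj.1 hj.2]
    ring
  rw [Finset.sum_congr rfl hterm, Finset.sum_const, Nat.card_Icc, nsmul_eq_mul] at hsum
  have h6 : ((6 + 1 - 1 : ℕ) : ℂ) = 6 := by norm_num
  rw [h6] at hsum
  have hsum' : 2 - LinearMap.trace ℂ _ T = 0 := (mul_eq_zero.1 hsum).resolve_left (by norm_num)
  intro j hj1 hj6
  rw [heq j hj1 hj6]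
  linear_combination (-1 : ℂ) * hsum'

end Curve

end Summit.HodgeConjecture.HodgeConjecture.Theorems.WeilTwelvefoldsSqrtMinus7.IsotypicUnimodularSaturation

end
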